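import Literature.NumberTheory.GelbartRogawski1991.ThetaDichotomyVocabulary      -- ★ `xThetaGqsCM`, `Gqs`, `cmDatumLocalCongr`, `localLineInl`, `localPiEquiv` (the chart `ch_T`)
import Literature.NumberTheory.GelbartRogawski1991.LocalUnitaryFrameTransport     -- ★ `FrameTransport.framePloc` ∕ `frameConjLocal` ∕ `frameConj` ∕ `frameOp` ∕ `frameSection`
import Literature.NumberTheory.GelbartRogawski1991.UnitaryDualPairThetaKernelCM   -- ★ `realDiagonal`, `realDiagonal_map`
import Literature.NumberTheory.Automorphic.UnitaryGroupLocalIntegralMembership -- ★ `localGram_eq_map` (the local Gram matrix of `J` is `J ⊗ 1`, definitional)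
import Mathlib.RepresentationTheory.Coinvariants                            -- `Representation.Coinvariants.ker` (the Jacquet kernel of the (E4) dictionary)
import Literature.NumberTheory.GelbartRogawski1991.UnitaryDualPairLocalReferenceSection -- ★ `gram`, `reindex_kronecker_eq_gram_map`, `isSymm_gram`; brings `FinLocalSplittings`
import HarnessLib

/-!
# Crux `H413` — N3 ROAD (a), row (FX): FRAME TRANSPORT OF THE (E4) DICTIONARY — §1 the group identity `frameConj_P ∘ ch_{T′} = ch_T`

F0∕P2, cell `hodgecm-mathlib`, crux item `stmt-HodgeConjecture-24833`; A-p01 (g19) on the K1∕N3 lead B-p18 (g29)'s dealing 2026-08-31T22:14:55Z (2).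
PROOF lane (theorems only; no `def`, no instance, no notation, no `sorry`); `--supports stmt-HodgeConjecture-24833 --as helper`.
HONEST LABEL: HC_CM is proved only modulo the printed citations until rung 0 closes; this file proves NO letter — it is plumbing for the
(a)-side assembler of N3 #96 (`GelbartRogawski1991.thetaType_nonsplit_jacquetModule`).

THE SETTING.  `L` CM, `v` a finite place of `L⁺`, `dV, dV′ : Fin 3 → L` conjugation-fixed («real») diagonal Gram data, and a RATIONAL change of frame
`P ∈ GL₃(L⁺)` with `Pᵀ · diag(dV) · P = diag(dV′)` (★ `realDiagonal`).  The letters read Liu's local theta type on the quasi-split avatar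
`U(Φ₃)(L⁺_v)` (★ `Gqs L v`) through a CHART `ch_T := localLineInl ∘ localPiEquiv⁻¹ ∘ cmDatumLocalCongr T` along a form congruence
`ᵗT̄ · diag(dV)_v · T = a · Φ₃` (★ `xThetaGqsCM`).  ★ `FrameTransport.frameConj` is `U(diag dV′)(L⁺_v) ≃ₜ* U(diag dV)(L⁺_v)`, `g′ ↦ P g′ P⁻¹`.

§1 (this edition — the lead's «first lemma», statement-first): with `T′ := P⁻¹ T` (★ `framePloc`, `P` read in `GL₃(L ⊗ L⁺_v)`),
* `formCongr_framePloc_diagonal` — `ᵗP̄ · diag(dV)_v · P = diag(dV′)_v` at the `LocalRing` matrices (★ `formCongr_localForm` through ★ `localGram_eq_map`);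
* `formCongr_framePlocInv_mul` — the form congruence TRANSPORTS: `ᵗT̄′ · diag(dV′)_v · T′ = a · Φ₃` with the SAME scalar `a`;
* `frameConjLocal_cmDatumLocalCongr` ∕ **`frameConj_localPiEquiv_symm_cmDatumLocalCongr`** — THE GROUP IDENTITY `P · (P⁻¹T u T⁻¹P) · P⁻¹ = T u T⁻¹`:
  `frameConj_P (localPiEquiv⁻¹ (cmDatumLocalCongr T′ u)) = localPiEquiv⁻¹ (cmDatumLocalCongr T u)` for every `u ∈ U(Φ₃)(L⁺_v)`.
§1b (this edition): the PAIR-LEVEL square `frameConj_{reindex e (Q ⊗ 1)} (k ⊗ 1) = (frameConj_Q k) ⊗ 1` (generic `F ⊂ E`, any `N`, a line `W`), with the componentwise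
bookkeeping `(reindex e (A ⊗ 1))_𝔴 = reindex e (A_𝔴 ⊗ 1)`, `framePloc (reindex e (Q ⊗ 1)) = reindex e (framePloc Q ⊗ 1)`, `↑(frameConj g′) = P_𝔴 g′_𝔴 P_𝔴⁻¹` and the pair frame
identity `(reindex e (Q ⊗ 1))ᵀ · gram e T T_W · reindex e (Q ⊗ 1) = gram e T′ T_W`.
§2a (this edition, generic algebra): an (E4)-shaped dictionary `(π, σ, Tr, η)` TRANSPORTS along intertwiners `Φ` (group side) and `Φ₁` (line-model side) to
`(π ∘ Φ, σ, Φ₁⁻¹ ∘ Tr, η)` — the SAME `η` (`map_coinvariantsKer_eq`, `comap_coinvariantsKer_eq`, **`dictionary_transport`**).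
§2b (this edition): **`dictionary_frameTransport`** — the (E4)-shaped dictionary (F0P2-p01 (g8)'s `exists_dictionary_upToChar` four-clause shape, VERBATIM tokens:
`(MpPsi.toRep (localSchrodinger … (gram e₁ (realDiagonal dV) (TW ε)) v)).comp (𝓢.s v)` ∘ `localLineInl ∘ localPiEquiv⁻¹ ∘ cmDatumLocalCongr T` restricted to `N`, the centre
through ★ `localCenter`, the line model ★ `lineWeilCM … (kernelLineCM dV) … ε v`) for `(dV, T, 𝓢)` yields one for `(dV′, T′ := P⁻¹T, 𝓢′)` with the SAME `σ` and the SAME `η`,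
for ANY two packages `𝓢, 𝓢′` whose local Weil representations are `frameOp_{P ⊗ 1}`-intertwined along `frameConj_{P ⊗ 1}` (hypothesis `hS` = the shape of ★
`FrameTransport.frameOp_toRep_frameSection`, i.e. of B-p08 (g24)'s (FN) head (U) at the pair Gram) and ANY line-side intertwiner `Φ₁` (hypothesis `hΦ₁` = (FN) at rank 1
+ ★ `frameConj_localCenter`).  Group side fully discharged here: `Φ := frameOp_{P ⊗ 1}` intertwines by `hS` ∘ §1b ∘ §1, and fixes the centre by ★ `frameConj_localCenter`.
§2c (next edition, once (FN) is ★ for the CM packages of record ★ `chiLocalSplittingsCM` ∕ ★ `lineSplittingsCM`): `hS` and `hΦ₁` discharged BY NAME — `η_{dV,T} = η_{dV′,T′}`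
hypothesis-free.

References: [PlatonovRapinchuk1994] §2.3 (conjugate unitary groups); [MoeglinVignerasWaldspurger1987] Chap. 1 I.17, Chap. 2 II Remarque (3); [GelbartRogawski1991] §3.1 p. 454,
§3.2 p. 457; [BernsteinZelevinsky1976] §2.30 (coinvariants ∕ Jacquet functor).
-/

set_option autoImplicit false
-- the mandated namespace repeats `HodgeConjecture.HodgeConjecture`, as in every `Theorems/*.lean` of this sub-problem
set_option linter.dupNamespace false

noncomputable section

open NumberField IsDedekindDomain Matrix
open scoped MatrixGroups Kronecker
open Literature.NumberTheory.Automorphic Literature.NumberTheory.Automorphic.UnitaryGroup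
open Literature.NumberTheory.GelbartRogawski1991 Literature.NumberTheory.GelbartRogawski1991.UnitaryDualPair
open Literature.NumberTheory.GelbartRogawski1991.UnitaryDualPair.LocalSplitting Literature.NumberTheory.GelbartRogawski1991.UnitaryDualPair.WeilCoinv
open Literature.NumberTheory.GelbartRogawski1991.GRConstruction
open Literature.NumberTheory.Automorphic.IdeleClassGroup
open Literature.NumberTheory.Automorphic.Liu2021 Literature.NumberTheory.Automorphic.Liu2021.Def411WeilCarriers
open Literature.NumberTheory.Automorphic.Liu2021.Def411WeilCarriersDoubling
open Literature.RepresentationTheory Literature.RepresentationTheory.HeisenbergGroup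
open Literature.NumberTheory.GaloisRepresentations
open Literature.NumberTheory.Rogawski1990

namespace Summit.HodgeConjecture.HodgeConjecture.Cruxes.H413.F0P2oLineWeilDictionaryFrameTransport

variable (L : Type) [Field L] [NumberField L] [IsCMField L] (v : HeightOneSpectrum (𝓞 ↥(maximalRealSubfield L)))
  (dV dV' : Fin 3 → L) (hdV : ∀ i, IsCMField.complexConj L (dV i) = dV i) (hdV' : ∀ i, IsCMField.complexConj L (dV' i) = dV' i)
  (P : GL (Fin 3) ↥(maximalRealSubfield L))
  (hP : (P : Matrix (Fin 3) (Fin 3) ↥(maximalRealSubfield L))ᵀ * realDiagonal L dV hdV * (P : Matrix (Fin 3) (Fin 3) ↥(maximalRealSubfield L)) =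
    realDiagonal L dV' hdV')

/-! ## §1 The group identity `frameConj_P ∘ ch_{T′} = ch_T` -/

include hP in
/-- **`ᵗP̄ · diag(dV)_v · P = diag(dV′)_v`** at the `LocalRing` matrices (`P` is real, so `P̄ = P`): ★ `FrameTransport.formCongr_localForm` for the frames
`diag(dV) = realDiagonal ⊗ 1`, `diag(dV′) = realDiagonal′ ⊗ 1`. [cite: PlatonovRapinchuk1994, §2.3] -/
theorem formCongr_framePloc_diagonal :
    formCongr (conjLocal L (IsCMField.complexConj L) v) (FrameTransport.framePloc (↥(maximalRealSubfield L)) L v 3 P)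
        ((Matrix.diagonal dV).map (algebraMap L (LocalRing L v))) =
      (Matrix.diagonal dV').map (algebraMap L (LocalRing L v)) := by
  rw [← localGram_eq_map L v (Matrix.diagonal dV), ← localGram_eq_map L v (Matrix.diagonal dV')]
  exact FrameTransport.formCongr_localForm (↥(maximalRealSubfield L)) L (IsCMField.complexConj L) v 3
    (realDiagonal_map L dV hdV).symm (realDiagonal_map L dV' hdV').symm P hP

include hP in
/-- **the form congruence TRANSPORTS along the frame** — for `ᵗT̄ · diag(dV)_v · T = a · Φ₃` and `T′ := P⁻¹ T`: `ᵗT̄′ · diag(dV′)_v · T′ = a · Φ₃` with the SAME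
scalar `a` (`ᵗP⁻¹ · diag(dV′) · P⁻¹ = diag(dV)`). [cite: PlatonovRapinchuk1994, §2.3] -/
theorem formCongr_framePlocInv_mul (T : GL (Fin 3) (LocalRing L v)) (a : LocalRing L v)
    (h : formCongr (conjLocal L (IsCMField.complexConj L) v) T ((Matrix.diagonal dV).map (algebraMap L (LocalRing L v))) =
      a • (Matrix.of fun i j : Fin 3 => if i.val + j.val + 1 = 3 then (1 : L) else 0).map (algebraMap L (LocalRing L v))) :
    formCongr (conjLocal L (IsCMField.complexConj L) v) ((FrameTransport.framePloc (↥(maximalRealSubfield L)) L v 3 P)⁻¹ * T)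
        ((Matrix.diagonal dV').map (algebraMap L (LocalRing L v))) =
      a • (Matrix.of fun i j : Fin 3 => if i.val + j.val + 1 = 3 then (1 : L) else 0).map (algebraMap L (LocalRing L v)) := by
  -- `Q(P⁻¹ T) = Q_T (Q_{P⁻¹})` and `Q_{P⁻¹} (diag dV′) = diag dV`
  have hmul : formCongr (conjLocal L (IsCMField.complexConj L) v) ((FrameTransport.framePloc (↥(maximalRealSubfield L)) L v 3 P)⁻¹ * T)
      ((Matrix.diagonal dV').map (algebraMap L (LocalRing L v))) =
      formCongr (conjLocal L (IsCMField.complexConj L) v) T (formCongr (conjLocal L (IsCMField.complexConj L) v)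
        (FrameTransport.framePloc (↥(maximalRealSubfield L)) L v 3 P)⁻¹ ((Matrix.diagonal dV').map (algebraMap L (LocalRing L v)))) := by
    simp only [formCongr, Units.val_mul, Matrix.map_mul, Matrix.transpose_mul, Matrix.mul_assoc]
  rw [hmul, ← formCongr_framePloc_diagonal L v dV dV' hdV hdV' P hP, formCongr_inv_formCongr, h]

/-- **THE GROUP IDENTITY at the matrix avatars** — `P · ((P⁻¹T) u (P⁻¹T)⁻¹) · P⁻¹ = T u T⁻¹`: `frameConjLocal_P (cmDatumLocalCongr T′ u) = cmDatumLocalCongr T u` for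
`T′ = P⁻¹ T` and every `u ∈ U(Φ₃)(L⁺_v)` (the two form-congruence witnesses `h`, `h′` are arbitrary — proof-irrelevant). [cite: PlatonovRapinchuk1994, §2.3] -/
theorem frameConjLocal_cmDatumLocalCongr (T : GL (Fin 3) (LocalRing L v)) {a : LocalRing L v} (ha : IsUnit a)
    (h : formCongr (conjLocal L (IsCMField.complexConj L) v) T ((Matrix.diagonal dV).map (algebraMap L (LocalRing L v))) =
      a • (Matrix.of fun i j : Fin 3 => if i.val + j.val + 1 = 3 then (1 : L) else 0).map (algebraMap L (LocalRing L v)))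
    (T' : GL (Fin 3) (LocalRing L v)) (hT' : FrameTransport.framePloc (↥(maximalRealSubfield L)) L v 3 P * T' = T) {a' : LocalRing L v} (ha' : IsUnit a')
    (h' : formCongr (conjLocal L (IsCMField.complexConj L) v) T' ((Matrix.diagonal dV').map (algebraMap L (LocalRing L v))) =
      a' • (Matrix.of fun i j : Fin 3 => if i.val + j.val + 1 = 3 then (1 : L) else 0).map (algebraMap L (LocalRing L v)))
    (u : Gqs L v) :
    FrameTransport.frameConjLocal (↥(maximalRealSubfield L)) L (IsCMField.complexConj L) v 3 (realDiagonal_map L dV hdV).symm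
        (realDiagonal_map L dV' hdV').symm P hP (cmDatumLocalCongr L v T' ha' h' u) =
      cmDatumLocalCongr L v T ha h u := by
  refine Subtype.ext ?_
  rw [FrameTransport.coe_frameConjLocal]
  change FrameTransport.framePloc (↥(maximalRealSubfield L)) L v 3 P * (cmDatumLocalCongr L v T' ha' h' u).val *
      (FrameTransport.framePloc (↥(maximalRealSubfield L)) L v 3 P)⁻¹ = (cmDatumLocalCongr L v T ha h u).val
  rw [coe_cmDatumLocalCongr_apply, coe_cmDatumLocalCongr_apply, ← hT', _root_.mul_inv_rev]
  simp only [mul_assoc]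

/-- **THE GROUP IDENTITY `frameConj_P ∘ ch_{T′} = ch_T` on the factor forms `localPi`** (the lead's «first lemma» of (FX)): for `T′ = P⁻¹ T` and every
`u ∈ U(Φ₃)(L⁺_v)`, `frameConj_P (localPiEquiv⁻¹ (cmDatumLocalCongr T′ u)) = localPiEquiv⁻¹ (cmDatumLocalCongr T u)` in `U(diag dV)(L⁺_v)` — so every representation
of `U(diag dV)(L⁺_v)` read on `U(Φ₃)` through `ch_T` IS its `frameConj_P`-pullback read through `ch_{T′}`. [cite: PlatonovRapinchuk1994, §2.3] [cite: MoeglinVignerasWaldspurger1987, Chap. 2 II Remarque (3)] -/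
theorem frameConj_localPiEquiv_symm_cmDatumLocalCongr (T : GL (Fin 3) (LocalRing L v)) {a : LocalRing L v} (ha : IsUnit a)
    (h : formCongr (conjLocal L (IsCMField.complexConj L) v) T ((Matrix.diagonal dV).map (algebraMap L (LocalRing L v))) =
      a • (Matrix.of fun i j : Fin 3 => if i.val + j.val + 1 = 3 then (1 : L) else 0).map (algebraMap L (LocalRing L v)))
    (T' : GL (Fin 3) (LocalRing L v)) (hT' : FrameTransport.framePloc (↥(maximalRealSubfield L)) L v 3 P * T' = T) {a' : LocalRing L v} (ha' : IsUnit a')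
    (h' : formCongr (conjLocal L (IsCMField.complexConj L) v) T' ((Matrix.diagonal dV').map (algebraMap L (LocalRing L v))) =
      a' • (Matrix.of fun i j : Fin 3 => if i.val + j.val + 1 = 3 then (1 : L) else 0).map (algebraMap L (LocalRing L v)))
    (u : Gqs L v) :
    FrameTransport.frameConj (↥(maximalRealSubfield L)) L (IsCMField.complexConj L) v 3 (realDiagonal_map L dV hdV).symm
        (realDiagonal_map L dV' hdV').symm P hP
        ((localPiEquiv L (IsCMField.complexConj L) 3 (Matrix.diagonal dV') v).symm (cmDatumLocalCongr L v T' ha' h' u)) =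
      (localPiEquiv L (IsCMField.complexConj L) 3 (Matrix.diagonal dV) v).symm (cmDatumLocalCongr L v T ha h u) := by
  rw [FrameTransport.frameConj, ContinuousMulEquiv.trans_apply, ContinuousMulEquiv.trans_apply, ContinuousMulEquiv.apply_symm_apply,
    frameConjLocal_cmDatumLocalCongr L v dV dV' hdV hdV' P hP T ha h T' hT' ha' h' u]

/-- **the chart `ch_T` as a `frameConj_P`-pullback, `MonoidHom` form**: `frameConj_P ∘ (localPiEquiv⁻¹ ∘ cmDatumLocalCongr T′) = localPiEquiv⁻¹ ∘ cmDatumLocalCongr T`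
as homomorphisms `U(Φ₃)(L⁺_v) →* U(diag dV)(L⁺_v)` — the shape composed with ★ `localLineInl` inside ★ `xThetaGqsCM` and the (E4) dictionary's representation.
[cite: PlatonovRapinchuk1994, §2.3] -/
theorem frameConj_comp_chart (T : GL (Fin 3) (LocalRing L v)) {a : LocalRing L v} (ha : IsUnit a)
    (h : formCongr (conjLocal L (IsCMField.complexConj L) v) T ((Matrix.diagonal dV).map (algebraMap L (LocalRing L v))) =
      a • (Matrix.of fun i j : Fin 3 => if i.val + j.val + 1 = 3 then (1 : L) else 0).map (algebraMap L (LocalRing L v)))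
    (T' : GL (Fin 3) (LocalRing L v)) (hT' : FrameTransport.framePloc (↥(maximalRealSubfield L)) L v 3 P * T' = T) {a' : LocalRing L v} (ha' : IsUnit a')
    (h' : formCongr (conjLocal L (IsCMField.complexConj L) v) T' ((Matrix.diagonal dV').map (algebraMap L (LocalRing L v))) =
      a' • (Matrix.of fun i j : Fin 3 => if i.val + j.val + 1 = 3 then (1 : L) else 0).map (algebraMap L (LocalRing L v))) :
    (FrameTransport.frameConj (↥(maximalRealSubfield L)) L (IsCMField.complexConj L) v 3 (realDiagonal_map L dV hdV).symm
        (realDiagonal_map L dV' hdV').symm P hP).toMonoidHom.comp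
      ((localPiEquiv L (IsCMField.complexConj L) 3 (Matrix.diagonal dV') v).symm.toMulEquiv.toMonoidHom.comp
        (cmDatumLocalCongr L v T' ha' h' : Gqs L v ≃ₜ* (cmDatum L 3 (Matrix.diagonal dV')).Local v).toMulEquiv.toMonoidHom) =
    (localPiEquiv L (IsCMField.complexConj L) 3 (Matrix.diagonal dV) v).symm.toMulEquiv.toMonoidHom.comp
      (cmDatumLocalCongr L v T ha h : Gqs L v ≃ₜ* (cmDatum L 3 (Matrix.diagonal dV)).Local v).toMulEquiv.toMonoidHom := by
  ext u : 1
  exact frameConj_localPiEquiv_symm_cmDatumLocalCongr L v dV dV' hdV hdV' P hP T ha h T' hT' ha' h' u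


/-! ## §1b The pair-level square `frameConj_{reindex e₁ (P ⊗ 1)} ∘ localLineInl_{dV′} = localLineInl_{dV} ∘ frameConj_P` -/

section PairSquare

variable {F : Type} [Field F] [NumberField F] (E : Type) [Field E] [NumberField E] [Algebra F E] (c : E ≃ₐ[F] E)
  (N : ℕ) {n : ℕ} (e : Fin N × Fin 1 ≃ Fin n) (w : HeightOneSpectrum (𝓞 F))

omit [NumberField F] in
/-- **`(reindex e (A ⊗ 1))_𝔴 = reindex e (A_𝔴 ⊗ 1)` place by place**: `GLn.piEquiv (reindex e (A ⊗ 1)) = localLineGL (GLn.piEquiv A)` on `GL_n(E ⊗ F_w) = Π_𝔴 GL_n(E_𝔴)`.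
[cite: MoeglinVignerasWaldspurger1987, Chap. 1 I.17] -/
theorem localGLPiEquiv_reindexGL_kroneckerGL_one (A : GL (Fin N) (LocalRing E w)) :
    localGLPiEquiv E n w (UnitaryGroup.reindexGL e (kroneckerGL (A, 1))) = localLineGL E N e w (localGLPiEquiv E N w A) := by
  funext 𝔴
  refine Units.ext (Matrix.ext fun i j => ?_)
  rw [coe_localLineGL_apply, GLn.coe_piEquiv_apply, Matrix.map_apply, UnitaryGroup.coe_reindexGL, Matrix.reindex_apply, Matrix.reindex_apply,
    Matrix.submatrix_apply, Matrix.submatrix_apply, GLn.coe_piEquiv_apply, coe_kroneckerGL, Matrix.kroneckerMap_apply, Matrix.kroneckerMap_apply,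
    map_mul, Matrix.map_apply, Units.val_one, Matrix.one_apply, Matrix.one_apply]
  split_ifs <;> simp

/-- **the rational pair frame read locally is the local pair frame**: `framePloc (reindex e (P ⊗ 1)) = reindex e (framePloc P ⊗ 1)` in `GL_n(E ⊗ F_w)`.
[cite: PlatonovRapinchuk1994, §2.3] -/
theorem framePloc_reindexGL_kroneckerGL_one (Q : GL (Fin N) F) :
    FrameTransport.framePloc F E w n (UnitaryGroup.reindexGL e (kroneckerGL (Q, 1))) =
      UnitaryGroup.reindexGL e (kroneckerGL (FrameTransport.framePloc F E w N Q, 1)) := by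
  refine Units.ext (Matrix.ext fun i j => ?_)
  rw [FrameTransport.coe_framePloc, Matrix.map_apply, UnitaryGroup.coe_reindexGL, UnitaryGroup.coe_reindexGL, Matrix.reindex_apply, Matrix.reindex_apply,
    Matrix.submatrix_apply, Matrix.submatrix_apply, coe_kroneckerGL, coe_kroneckerGL, Matrix.kroneckerMap_apply, Matrix.kroneckerMap_apply, map_mul,
    FrameTransport.coe_framePloc, Matrix.map_apply, Units.val_one, Units.val_one, Matrix.one_apply, Matrix.one_apply]
  split_ifs <;> simp

variable {T T' : Matrix (Fin N) (Fin N) F} {J : Matrix (Fin N) (Fin N) E} (hJ : J = T.map (algebraMap F E))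
  {J' : Matrix (Fin N) (Fin N) E} (hJ' : J' = T'.map (algebraMap F E))
  (Q : GL (Fin N) F) (hQ : (Q : Matrix (Fin N) (Fin N) F)ᵀ * T * (Q : Matrix (Fin N) (Fin N) F) = T')

/-- **`frameConj` on underlying families**: `(P g′ P⁻¹)_𝔴 = P_𝔴 g′_𝔴 P_𝔴⁻¹`, i.e. `↑(frameConj g′) = GLn.piEquiv (framePloc P) · ↑g′ · (GLn.piEquiv (framePloc P))⁻¹` in
`Π_𝔴 GL_N(E_𝔴)`. [cite: PlatonovRapinchuk1994, §2.3] -/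
theorem coe_frameConj (g' : localPi E c N J' w) :
    ((FrameTransport.frameConj F E c w N hJ hJ' Q hQ g' : localPi E c N J w) : LocalGLPi E N w) =
      localGLPiEquiv E N w (FrameTransport.framePloc F E w N Q) * (g' : LocalGLPi E N w) * (localGLPiEquiv E N w (FrameTransport.framePloc F E w N Q))⁻¹ := by
  rw [FrameTransport.frameConj, ContinuousMulEquiv.trans_apply, ContinuousMulEquiv.trans_apply, coe_localPiEquiv_symm_apply,
    FrameTransport.coe_frameConjLocal, map_mul, map_mul, map_inv, coe_localPiEquiv_apply, ContinuousMulEquiv.apply_symm_apply]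

variable (TW : Matrix (Fin 1) (Fin 1) F) {JW : Matrix (Fin 1) (Fin 1) E} (hJW : JW = TW.map (algebraMap F E))

omit [NumberField F] in
include hQ in
/-- **the pair frame**: `(reindex e (P ⊗ 1))ᵀ · gram e T T_W · reindex e (P ⊗ 1) = gram e T′ T_W` for `Pᵀ T P = T′` (★ `gram e T T_W = reindex e e (T ⊗ T_W)`).
[cite: GelbartRogawski1991, §3.1 p. 454] -/
theorem transpose_pairFrame_mul_gram_mul_pairFrame :
    ((UnitaryGroup.reindexGL e (kroneckerGL (Q, 1)) : GL (Fin n) F) : Matrix (Fin n) (Fin n) F)ᵀ * UnitaryDualPair.gram F e T TW *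
        ((UnitaryGroup.reindexGL e (kroneckerGL (Q, 1)) : GL (Fin n) F) : Matrix (Fin n) (Fin n) F) = UnitaryDualPair.gram F e T' TW := by
  rw [UnitaryGroup.coe_reindexGL, coe_kroneckerGL, Units.val_one, UnitaryDualPair.gram, UnitaryDualPair.gram, Matrix.reindex_apply, Matrix.reindex_apply,
    Matrix.reindex_apply, Matrix.transpose_submatrix, UnitaryGroup.kronecker_transpose, Matrix.transpose_one, Matrix.submatrix_mul_equiv, Matrix.submatrix_mul_equiv,
    ← Matrix.mul_kronecker_mul, ← Matrix.mul_kronecker_mul, Matrix.one_mul, Matrix.mul_one, hQ]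

/-- **THE PAIR-LEVEL SQUARE**: for `k ∈ U(J′)(F_w)` (`J′ = T′ ⊗ 1`), `frameConj_{reindex e (Q ⊗ 1)} (k ⊗ 1) = (frameConj_Q k) ⊗ 1` in `U(reindex e (J ⊗ J_W))(F_w)` — the frame
transport commutes with the first member `k ↦ reindex e (k ⊗ 1)` of the dual pair with a LINE `W`. [cite: MoeglinVignerasWaldspurger1987, Chap. 1 I.17; Chap. 2 II Remarque (3)]
[cite: GelbartRogawski1991, §3.2 p. 457] -/
theorem frameConj_localLineInl (k : localPi E c N J' w) :
    FrameTransport.frameConj F E c w n (reindex_kronecker_eq_gram_map F E e hJ hJW) (reindex_kronecker_eq_gram_map F E e hJ' hJW)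
        (UnitaryGroup.reindexGL e (kroneckerGL (Q, 1))) (transpose_pairFrame_mul_gram_mul_pairFrame N e Q hQ TW)
        (localLineInl E c N e J' JW w k) =
      localLineInl E c N e J JW w (FrameTransport.frameConj F E c w N hJ hJ' Q hQ k) := by
  refine Subtype.ext ?_
  rw [coe_frameConj, coe_localLineInl, coe_localLineInl, coe_frameConj, framePloc_reindexGL_kroneckerGL_one, localGLPiEquiv_reindexGL_kroneckerGL_one,
    map_mul, map_mul, map_inv]

end PairSquare


/-! ## §2a Generic transport of an (E4)-shaped dictionary `(π, σ, Tr, η)` along frame intertwiners (the character `η` is frame-invariant) -/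

section GenericTransport

open Representation

variable {k : Type*} [CommRing k] {G U : Type*} [Group G] [Group U]
  {S S' M M₁ M₁' : Type*} [AddCommGroup S] [Module k S] [AddCommGroup S'] [Module k S'] [AddCommGroup M] [Module k M]
  [AddCommGroup M₁] [Module k M₁] [AddCommGroup M₁'] [Module k M₁']

/-- **transport of `Coinvariants.ker` along an intertwining linear equivalence**: `Φ(⟨ρ′ g x − x⟩) = ⟨ρ g y − y⟩` for `Φ ∘ ρ′(g) = ρ(g) ∘ Φ`. [cite: BernsteinZelevinsky1976, §2.30] -/
theorem map_coinvariantsKer_eq (ρ : Representation k G S) (ρ' : Representation k G S') (Φ : S' ≃ₗ[k] S)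
    (hΦ : ∀ g f, Φ (ρ' g f) = ρ g (Φ f)) :
    (Coinvariants.ker ρ').map (Φ : S' →ₗ[k] S) = Coinvariants.ker ρ := by
  apply le_antisymm
  · rw [Submodule.map_le_iff_le_comap, Coinvariants.ker, Submodule.span_le]
    rintro _ ⟨⟨g, x⟩, rfl⟩
    rw [SetLike.mem_coe, Submodule.mem_comap, LinearEquiv.coe_coe, map_sub, hΦ]
    exact Coinvariants.sub_mem_ker g (Φ x)
  · rw [Coinvariants.ker, Submodule.span_le]
    rintro _ ⟨⟨g, y⟩, rfl⟩
    refine ⟨ρ' g (Φ.symm y) - Φ.symm y, Coinvariants.sub_mem_ker g (Φ.symm y), ?_⟩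
    rw [LinearEquiv.coe_coe, map_sub, hΦ, LinearEquiv.apply_symm_apply]

/-- comap form: **`Φ⁻¹(Coinvariants.ker ρ) = Coinvariants.ker ρ′`** — the Jacquet kernel is transported by a frame intertwiner. [cite: BernsteinZelevinsky1976, §2.30] -/
theorem comap_coinvariantsKer_eq (ρ : Representation k G S) (ρ' : Representation k G S') (Φ : S' ≃ₗ[k] S)
    (hΦ : ∀ g f, Φ (ρ' g f) = ρ g (Φ f)) :
    (Coinvariants.ker ρ).comap (Φ : S' →ₗ[k] S) = Coinvariants.ker ρ' := by
  rw [← map_coinvariantsKer_eq ρ ρ' Φ hΦ, Submodule.comap_map_eq_of_injective Φ.injective]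

/-- **GENERIC TRANSPORT OF AN (E4)-SHAPED DICTIONARY ALONG FRAME INTERTWINERS — THE CHARACTER `η` IS UNCHANGED.**  Data: two representations
`ρ, ρ′` of `G` (in the application: `(ω_v ∘ ch_T)|_N` and `(ω′_v ∘ ch_{T′})|_N`) intertwined by `Φ : S′ ≃ S` (`frameOp_{P ⊗ 1}`), two centre actions `ζ, ζ′` of `U`
(`ω_v ∘ localCenter`, `ω′_v ∘ localCenter′`) intertwined by the same `Φ` (★ `frameConj_localCenter`), and two target line models `Lr, Lr′` of `U` (`lineWeilCM` at
`kernelLineCM dV` ∕ `kernelLineCM dV′`) intertwined by `Φ₁ : M₁′ ≃ M₁` (`frameOp_{det P ⊗ 1}`).  Then every dictionary `(π, σ, Tr, η)` for `(ρ, ζ, Lr)` — `π` surjective with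
`ker π = Coinvariants.ker ρ`, `π ∘ ζ(u) = σ(u) ∘ π`, `Lr(u) ∘ Tr = η(u) · Tr ∘ σ(u)` — yields the dictionary `(π ∘ Φ, σ, Φ₁⁻¹ ∘ Tr, η)` for `(ρ′, ζ′, Lr′)` with the SAME
`σ` and the SAME `η`. [cite: MoeglinVignerasWaldspurger1987, Chap. 2 II Remarque (3)] [cite: BernsteinZelevinsky1976, §2.30] -/
theorem dictionary_transport (ρ : Representation k G S) (ρ' : Representation k G S') (ζ : Representation k U S) (ζ' : Representation k U S')
    (Φ : S' ≃ₗ[k] S) (hΦ : ∀ g f, Φ (ρ' g f) = ρ g (Φ f)) (hΦζ : ∀ u f, Φ (ζ' u f) = ζ u (Φ f))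
    (Lr : Representation k U M₁) (Lr' : Representation k U M₁') (Φ₁ : M₁' ≃ₗ[k] M₁) (hΦ₁ : ∀ u m, Φ₁ (Lr' u m) = Lr u (Φ₁ m))
    (η : U →* kˣ)
    (h : ∃ (π : S →ₗ[k] M) (σ : Representation k U M) (Tr : M ≃ₗ[k] M₁),
      Function.Surjective π ∧ LinearMap.ker π = Coinvariants.ker ρ ∧ (∀ u f, π (ζ u f) = σ u (π f)) ∧
        ∀ u s, Lr u (Tr s) = ((η u : kˣ) : k) • Tr (σ u s)) :
    ∃ (π' : S' →ₗ[k] M) (σ : Representation k U M) (Tr' : M ≃ₗ[k] M₁'),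
      Function.Surjective π' ∧ LinearMap.ker π' = Coinvariants.ker ρ' ∧ (∀ u f, π' (ζ' u f) = σ u (π' f)) ∧
        ∀ u s, Lr' u (Tr' s) = ((η u : kˣ) : k) • Tr' (σ u s) := by
  obtain ⟨π, σ, Tr, hsurj, hker, hζ, hTr⟩ := h
  refine ⟨π ∘ₗ (Φ : S' →ₗ[k] S), σ, Tr.trans Φ₁.symm, hsurj.comp Φ.surjective, ?_, fun u f => ?_, fun u s => ?_⟩
  · rw [LinearMap.ker_comp, hker, comap_coinvariantsKer_eq ρ ρ' Φ hΦ]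
  · rw [LinearMap.comp_apply, LinearMap.comp_apply, LinearEquiv.coe_coe, hΦζ, hζ]
  · apply Φ₁.injective
    rw [LinearEquiv.trans_apply, LinearEquiv.trans_apply, hΦ₁, LinearEquiv.apply_symm_apply, hTr, map_smul, LinearEquiv.apply_symm_apply]

end GenericTransport


/-! ## §2b The CM instantiation of the group side: the (E4)-shaped dictionary for `(dV, T, 𝓢)` yields one for `(dV′, T′, 𝓢′)` with the SAME `η`,
for ANY two local splitting packages `𝓢, 𝓢′` of the pairs `U(diag dV ⊗ (ε))`, `U(diag dV′ ⊗ (ε))` that are `frameOp_{P ⊗ 1}`-INTERTWINED (hypothesis `hS` —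
the (FN) head (U) of B-p08 (g24) for the CM packages of record) and any `frameOp`-type intertwiner `Φ₁` of the two rank-one line models (hypothesis `hΦ₁` — (FN) at rank 1). -/

section CMTransport

variable {n' : ℕ} (e₁ : Fin 3 × Fin 1 ≃ Fin n') (hdV0 : ∀ i, dV i ≠ 0) (hdV0' : ∀ i, dV' i ≠ 0) (ε : (↥(maximalRealSubfield L))ˣ)
  (𝓢 : FinLocalSplittings (↥(maximalRealSubfield L)) L (IsCMField.complexConj L) n' (complexConj_imagUnit L) (imagUnit_ne_zero L)
    (imagUnit_mul_self L) (UnitaryDualPair.gram (↥(maximalRealSubfield L)) e₁ (realDiagonal L dV hdV) (TW (↥(maximalRealSubfield L)) ε))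
    (isSymm_gram (↥(maximalRealSubfield L)) e₁ (realDiagonal_isSymm L dV hdV) (isSymm_TW (↥(maximalRealSubfield L)) ε))
    (J := Matrix.reindex e₁ e₁ (Matrix.diagonal dV ⊗ₖ JW (↥(maximalRealSubfield L)) L ε))
    (reindex_kronecker_eq_gram_map (↥(maximalRealSubfield L)) L e₁ (realDiagonal_map L dV hdV).symm (JW_eq (↥(maximalRealSubfield L)) L ε)))
  (𝓢' : FinLocalSplittings (↥(maximalRealSubfield L)) L (IsCMField.complexConj L) n' (complexConj_imagUnit L) (imagUnit_ne_zero L)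
    (imagUnit_mul_self L) (UnitaryDualPair.gram (↥(maximalRealSubfield L)) e₁ (realDiagonal L dV' hdV') (TW (↥(maximalRealSubfield L)) ε))
    (isSymm_gram (↥(maximalRealSubfield L)) e₁ (realDiagonal_isSymm L dV' hdV') (isSymm_TW (↥(maximalRealSubfield L)) ε))
    (J := Matrix.reindex e₁ e₁ (Matrix.diagonal dV' ⊗ₖ JW (↥(maximalRealSubfield L)) L ε))
    (reindex_kronecker_eq_gram_map (↥(maximalRealSubfield L)) L e₁ (realDiagonal_map L dV' hdV').symm (JW_eq (↥(maximalRealSubfield L)) L ε)))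


set_option synthInstance.maxHeartbeats 400000 in
set_option maxHeartbeats 4000000 in
/-- **THE (E4) DICTIONARY TRANSPORTS ALONG A RATIONAL FRAME — SAME `η` (group side instantiated; §2a at the CM tokens).**  Frames: `P ∈ GL₃((↥(maximalRealSubfield L)))`,
`Pᵀ diag(dV) P = diag(dV′)`, the pair frame `reindex e₁ (P ⊗ 1)` (§1b); `T′` with `P·T′ = T` (§1).  Packages: ANY `𝓢` over `diag dV ⊗ (ε)` and `𝓢′` over
`diag dV′ ⊗ (ε)` whose local Weil representations are `frameOp_{P⊗1}`-intertwined along `frameConj_{P⊗1}` (`hS`, the shape of ★ `FrameTransport.frameOp_toRep_frameSection`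
∕ B-p08 (g24)'s (FN) head (U)).  Line side: ANY `Φ₁` intertwining `lineWeilCM` at `kernelLineCM dV′` with `lineWeilCM` at `kernelLineCM dV` (`hΦ₁`).  Then an (E4)-shaped
dictionary `(π, σ, Tr, η)` for the chart `ch_T` of `dV` (F0P2-p01 (g8)'s `exists_dictionary_upToChar` shape: `π` surjective, `ker π` = the `N`-coinvariant kernel of `ω_v ∘ ch_T`,
`π` descends the centre action to `σ`, `Tr` matches `σ` to the line model up to `η`) yields one for the chart `ch_{T′}` of `dV′` with the SAME `σ` and the SAME `η`.
Ingredients: §1 `frameConj_P ∘ (localPiEquiv⁻¹ ∘ cmDatumLocalCongr T′) = localPiEquiv⁻¹ ∘ cmDatumLocalCongr T`, §1b `frameConj_{P⊗1} ∘ localLineInl′ = localLineInl ∘ frameConj_P`,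
★ `frameConj_localCenter` (the pair frame FIXES the `U((ε))`-member), §2a `dictionary_transport`.
[cite: MoeglinVignerasWaldspurger1987, Chap. 2 II Remarque (3); Chap. 1 I.17] [cite: GelbartRogawski1991, §3.2 (3.2.1)–(3.2.2) p. 457] [cite: PlatonovRapinchuk1994, §2.3] -/
theorem dictionary_frameTransport
    (hS : ∀ (g' : localPi L (IsCMField.complexConj L) n' (Matrix.reindex e₁ e₁ (Matrix.diagonal dV' ⊗ₖ JW (↥(maximalRealSubfield L)) L ε)) v) (f : SchwartzBruhat (Fin n' → v.adicCompletion (↥(maximalRealSubfield L)))),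
      FrameTransport.frameOp (↥(maximalRealSubfield L)) v n' (UnitaryGroup.reindexGL e₁ (kroneckerGL (P, 1)))
          (MpPsi.toRep (localSchrodinger (↥(maximalRealSubfield L)) n' (UnitaryDualPair.gram (↥(maximalRealSubfield L)) e₁ (realDiagonal L dV' hdV') (TW (↥(maximalRealSubfield L)) ε)) v) (𝓢'.s v g') f) =
        MpPsi.toRep (localSchrodinger (↥(maximalRealSubfield L)) n' (UnitaryDualPair.gram (↥(maximalRealSubfield L)) e₁ (realDiagonal L dV hdV) (TW (↥(maximalRealSubfield L)) ε)) v)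
          (𝓢.s v (FrameTransport.frameConj (↥(maximalRealSubfield L)) L (IsCMField.complexConj L) v n'
            (reindex_kronecker_eq_gram_map (↥(maximalRealSubfield L)) L e₁ (realDiagonal_map L dV hdV).symm (JW_eq (↥(maximalRealSubfield L)) L ε))
            (reindex_kronecker_eq_gram_map (↥(maximalRealSubfield L)) L e₁ (realDiagonal_map L dV' hdV').symm (JW_eq (↥(maximalRealSubfield L)) L ε))
            (UnitaryGroup.reindexGL e₁ (kroneckerGL (P, 1))) (transpose_pairFrame_mul_gram_mul_pairFrame 3 e₁ P hP (TW (↥(maximalRealSubfield L)) ε)) g'))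
          (FrameTransport.frameOp (↥(maximalRealSubfield L)) v n' (UnitaryGroup.reindexGL e₁ (kroneckerGL (P, 1))) f))
    (T : GL (Fin 3) (LocalRing L v)) {a : LocalRing L v} (ha : IsUnit a)
    (h : formCongr (conjLocal L (IsCMField.complexConj L) v) T ((Matrix.diagonal dV).map (algebraMap L (LocalRing L v))) =
      a • (Matrix.of fun i j : Fin 3 => if i.val + j.val + 1 = 3 then (1 : L) else 0).map (algebraMap L (LocalRing L v)))
    (T' : GL (Fin 3) (LocalRing L v)) (hT' : FrameTransport.framePloc (↥(maximalRealSubfield L)) L v 3 P * T' = T) {a' : LocalRing L v} (ha' : IsUnit a')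
    (h' : formCongr (conjLocal L (IsCMField.complexConj L) v) T' ((Matrix.diagonal dV').map (algebraMap L (LocalRing L v))) =
      a' • (Matrix.of fun i j : Fin 3 => if i.val + j.val + 1 = 3 then (1 : L) else 0).map (algebraMap L (LocalRing L v)))
    (N : Subgroup (Gqs L v))
    {n₀ : ℕ} (e₀ : Fin 1 × Fin 1 ≃ Fin n₀) (μ : Literature.NumberTheory.Automorphic.IdeleClassGroup L →ₜ* Circle) (hμ : IsConjugateSymplectic L μ)
    (Φ₁ : SchwartzBruhat (Fin n₀ → v.adicCompletion (↥(maximalRealSubfield L))) ≃ₗ[ℂ] SchwartzBruhat (Fin n₀ → v.adicCompletion (↥(maximalRealSubfield L))))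
    (hΦ₁ : ∀ (u : localPi L (IsCMField.complexConj L) 1 (JW (↥(maximalRealSubfield L)) L ε) v) (m : SchwartzBruhat (Fin n₀ → v.adicCompletion (↥(maximalRealSubfield L)))),
      Φ₁ (lineWeilCM L e₀ (kernelLineCM dV') (complexConj_kernelLineCM dV' hdV') (kernelLineCM_ne_zero dV' hdV0') μ hμ ε v u m) =
        lineWeilCM L e₀ (kernelLineCM dV) (complexConj_kernelLineCM dV hdV) (kernelLineCM_ne_zero dV hdV0) μ hμ ε v u (Φ₁ m))
    {M : Type} [AddCommGroup M] [Module ℂ M] (η : localPi L (IsCMField.complexConj L) 1 (JW (↥(maximalRealSubfield L)) L ε) v →* ℂˣ)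
    (hdict : ∃ (π : SchwartzBruhat (Fin n' → v.adicCompletion (↥(maximalRealSubfield L))) →ₗ[ℂ] M) (σ : Representation ℂ (localPi L (IsCMField.complexConj L) 1 (JW (↥(maximalRealSubfield L)) L ε) v) M)
        (Tr : M ≃ₗ[ℂ] SchwartzBruhat (Fin n₀ → v.adicCompletion (↥(maximalRealSubfield L)))),
      Function.Surjective π ∧
      LinearMap.ker π = Representation.Coinvariants.ker
        ((((MpPsi.toRep (localSchrodinger (↥(maximalRealSubfield L)) n' (UnitaryDualPair.gram (↥(maximalRealSubfield L)) e₁ (realDiagonal L dV hdV) (TW (↥(maximalRealSubfield L)) ε)) v)).comp (𝓢.s v)).comp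
          ((localLineInl L (IsCMField.complexConj L) 3 e₁ (Matrix.diagonal dV) (JW (↥(maximalRealSubfield L)) L ε) v).comp
            ((localPiEquiv L (IsCMField.complexConj L) 3 (Matrix.diagonal dV) v).symm.toMonoidHom.comp (cmDatumLocalCongr L v T ha h).toMonoidHom))).comp N.subtype) ∧
      (∀ (u : localPi L (IsCMField.complexConj L) 1 (JW (↥(maximalRealSubfield L)) L ε) v) (f : SchwartzBruhat (Fin n' → v.adicCompletion (↥(maximalRealSubfield L)))),
        π (MpPsi.toRep (localSchrodinger (↥(maximalRealSubfield L)) n' (UnitaryDualPair.gram (↥(maximalRealSubfield L)) e₁ (realDiagonal L dV hdV) (TW (↥(maximalRealSubfield L)) ε)) v)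
          (𝓢.s v (localCenter L (IsCMField.complexConj L) n' (Matrix.reindex e₁ e₁ (Matrix.diagonal dV ⊗ₖ JW (↥(maximalRealSubfield L)) L ε)) (JW (↥(maximalRealSubfield L)) L ε) (JW_apply_ne_zero (↥(maximalRealSubfield L)) L ε) v u)) f) = σ u (π f)) ∧
      ∀ (u : localPi L (IsCMField.complexConj L) 1 (JW (↥(maximalRealSubfield L)) L ε) v) (m : M),
        lineWeilCM L e₀ (kernelLineCM dV) (complexConj_kernelLineCM dV hdV) (kernelLineCM_ne_zero dV hdV0) μ hμ ε v u (Tr m) = ((η u : ℂˣ) : ℂ) • Tr (σ u m)) :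
    ∃ (π' : SchwartzBruhat (Fin n' → v.adicCompletion (↥(maximalRealSubfield L))) →ₗ[ℂ] M) (σ : Representation ℂ (localPi L (IsCMField.complexConj L) 1 (JW (↥(maximalRealSubfield L)) L ε) v) M)
        (Tr' : M ≃ₗ[ℂ] SchwartzBruhat (Fin n₀ → v.adicCompletion (↥(maximalRealSubfield L)))),
      Function.Surjective π' ∧
      LinearMap.ker π' = Representation.Coinvariants.ker
        ((((MpPsi.toRep (localSchrodinger (↥(maximalRealSubfield L)) n' (UnitaryDualPair.gram (↥(maximalRealSubfield L)) e₁ (realDiagonal L dV' hdV') (TW (↥(maximalRealSubfield L)) ε)) v)).comp (𝓢'.s v)).comp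
          ((localLineInl L (IsCMField.complexConj L) 3 e₁ (Matrix.diagonal dV') (JW (↥(maximalRealSubfield L)) L ε) v).comp
            ((localPiEquiv L (IsCMField.complexConj L) 3 (Matrix.diagonal dV') v).symm.toMonoidHom.comp (cmDatumLocalCongr L v T' ha' h').toMonoidHom))).comp N.subtype) ∧
      (∀ (u : localPi L (IsCMField.complexConj L) 1 (JW (↥(maximalRealSubfield L)) L ε) v) (f : SchwartzBruhat (Fin n' → v.adicCompletion (↥(maximalRealSubfield L)))),
        π' (MpPsi.toRep (localSchrodinger (↥(maximalRealSubfield L)) n' (UnitaryDualPair.gram (↥(maximalRealSubfield L)) e₁ (realDiagonal L dV' hdV') (TW (↥(maximalRealSubfield L)) ε)) v)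
          (𝓢'.s v (localCenter L (IsCMField.complexConj L) n' (Matrix.reindex e₁ e₁ (Matrix.diagonal dV' ⊗ₖ JW (↥(maximalRealSubfield L)) L ε)) (JW (↥(maximalRealSubfield L)) L ε) (JW_apply_ne_zero (↥(maximalRealSubfield L)) L ε) v u)) f) = σ u (π' f)) ∧
      ∀ (u : localPi L (IsCMField.complexConj L) 1 (JW (↥(maximalRealSubfield L)) L ε) v) (m : M),
        lineWeilCM L e₀ (kernelLineCM dV') (complexConj_kernelLineCM dV' hdV') (kernelLineCM_ne_zero dV' hdV0') μ hμ ε v u (Tr' m) = ((η u : ℂˣ) : ℂ) • Tr' (σ u m) := by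
  refine dictionary_transport _ _
    (((MpPsi.toRep (localSchrodinger (↥(maximalRealSubfield L)) n' (UnitaryDualPair.gram (↥(maximalRealSubfield L)) e₁ (realDiagonal L dV hdV) (TW (↥(maximalRealSubfield L)) ε)) v)).comp (𝓢.s v)).comp
      (localCenter L (IsCMField.complexConj L) n' (Matrix.reindex e₁ e₁ (Matrix.diagonal dV ⊗ₖ JW (↥(maximalRealSubfield L)) L ε)) (JW (↥(maximalRealSubfield L)) L ε)
        (JW_apply_ne_zero (↥(maximalRealSubfield L)) L ε) v))
    (((MpPsi.toRep (localSchrodinger (↥(maximalRealSubfield L)) n' (UnitaryDualPair.gram (↥(maximalRealSubfield L)) e₁ (realDiagonal L dV' hdV') (TW (↥(maximalRealSubfield L)) ε)) v)).comp (𝓢'.s v)).comp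
      (localCenter L (IsCMField.complexConj L) n' (Matrix.reindex e₁ e₁ (Matrix.diagonal dV' ⊗ₖ JW (↥(maximalRealSubfield L)) L ε)) (JW (↥(maximalRealSubfield L)) L ε)
        (JW_apply_ne_zero (↥(maximalRealSubfield L)) L ε) v))
    (FrameTransport.frameOp (↥(maximalRealSubfield L)) v n' (UnitaryGroup.reindexGL e₁ (kroneckerGL (P, 1)))) ?_ ?_ _ _ Φ₁ hΦ₁ η hdict
  · -- the group side on `N`: `frameOp ∘ ω′(ch_{T′} g) = ω(ch_T g) ∘ frameOp` — hS, then §1b across `localLineInl`, then §1 across the chart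
    intro g f
    simp only [MonoidHom.comp_apply]
    rw [hS, frameConj_localLineInl L (IsCMField.complexConj L) 3 e₁ v (realDiagonal_map L dV hdV).symm (realDiagonal_map L dV' hdV').symm P hP
      (TW (↥(maximalRealSubfield L)) ε) (JW_eq (↥(maximalRealSubfield L)) L ε)]
    exact congrArg (fun x => MpPsi.toRep (localSchrodinger (↥(maximalRealSubfield L)) n'
        (UnitaryDualPair.gram (↥(maximalRealSubfield L)) e₁ (realDiagonal L dV hdV) (TW (↥(maximalRealSubfield L)) ε)) v)
        (𝓢.s v (localLineInl L (IsCMField.complexConj L) 3 e₁ (Matrix.diagonal dV) (JW (↥(maximalRealSubfield L)) L ε) v x))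
        (FrameTransport.frameOp (↥(maximalRealSubfield L)) v n' (UnitaryGroup.reindexGL e₁ (kroneckerGL (P, 1))) f))
      (frameConj_localPiEquiv_symm_cmDatumLocalCongr L v dV dV' hdV hdV' P hP T ha h T' hT' ha' h' (g : Gqs L v))
  · -- the centre: `frameConj_{P ⊗ 1}` FIXES `localCenter u`
    intro u f
    simp only [MonoidHom.comp_apply]
    rw [hS, FrameTransport.frameConj_localCenter]

end CMTransport

end Summit.HodgeConjecture.HodgeConjecture.Cruxes.H413.F0P2oLineWeilDictionaryFrameTransport

end
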